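import Summits.NavierStokesRegularity.FluidComputer.BlockEnergyIdentity
import Literature.Analysis.FluidPDE.MollifiedSliceTools
import HarnessLib

/-!
# Fluid computer — L16: the FLUX face of the level dictionary (band flux ≥ band rent − band stock)

HONEST FRAMING (cell `pub-fluidc`, verbatim): *low prior, high value-of-information experiment on Tao's
machine paradigm; NOT a claim that NS blows up.* Theorem side of the cell (necessities every cascade design must
respect); nothing here is evidence of blow-up, and nothing is said about any fixed finite set of levels.

The signed balance of `BlockEnergyIdentity` (`‖Δ̇_j u(t)‖₂² − ‖Δ̇_j u(s)‖₂² = 2∫_s^t(−ν S_j − N_j)` along every maximal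
smooth finite-energy solution) ADDS over levels. For a finite band of levels `B` the sum `Π_B(τ) = −∑_{j ∈ B} N_j(u(τ))`
is the net ENERGY FLUX into the band at time `τ` (energy merely passing between two levels of `B` cancels: this is the
Littlewood–Paley flux of Cheskidov–Constantin–Friedlander–Shvydkoy when `B = {j ≥ J}` is truncated). This file reads
the balance as a flux floor:

* `band_flux_ge` (**L16 — BAND FLUX ≥ BAND RENT − BAND STOCK**) — for all `0 < s ≤ t < T` and every finite set of
  levels `B`: `∫_s^t Π_B(u(τ)) dτ ≥ (ν/(3C_r²)) ∑_{j∈B} 4^j ∫_s^t ‖Δ̇_j u(τ)‖₂² dτ − ½ ∑_{j∈B} ‖Δ̇_j u(s)‖₂²`: the net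
  energy handed INTO a band over a window pays at least the band's viscous rent (rate `ν k_j²/(3C_r²)` per level, times
  energy-time) minus the band's initial stock.
* bookkeeping for the forward-flux floor of `ForwardFluxFloor.lean` (L16′: in every terminal window the net flux into some
  high band is POSITIVE and ≥ `κ ν³ 2^{-3q/2}/‖u₀‖₂`, infinitely often): the window sup-amplitude ≤ energy
  (`exists_iSup_blockSup_le_energy`), truncation of a tail integral to a shorter window (`exists_lt_setLIntegral_Ioo_of_lt`,
  monotone convergence), block energy-time in real form (`setLIntegral_blockL2_sq_eq_ofReal`), and the stock bound
  `4^q ∑_{k<N} ‖Δ̇_{q+k} w‖₂² ≤ F(w) < ∞` (`four_pow_mul_sum_blockL2_sq_le`, `dyadicF_ne_top`).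

0 sorry; no new definitions, no named facts (inputs: `BlockEnergyIdentity.neg_integral_transfer_ge` /
`blockL2_sq_toReal_sub_eq`, `exists_eLpNorm_top_blockFn_le`, `IsLerayHopfOn.eLpNorm_le_eLpNorm_datum`,
`LPBounds.dyadicF_le_gradSq`, `BlockEnergyContinuity.continuousOn_blockL2_sq`).

## References

* A. Cheskidov, P. Constantin, S. Friedlander, R. Shvydkoy, *Energy conservation and Onsager's conjecture for the Euler
  equations*, Nonlinearity 21 (2008) 1233–1252 (Littlewood–Paley energy flux). [CCFS2008]
* A. Cheskidov, R. Shvydkoy, Arch. Ration. Mech. Anal. 195 (2010) 159–169, Lemma 3.2 (proof, (8)). [CheskidovShvydkoy2010]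
* A. Cheskidov, M. Dai, arXiv:1507.06611 = Proc. Edinburgh Math. Soc. (2025), Thm. 1.1. [CheskidovDai2015]
-/

noncomputable section

open MeasureTheory Set Function Filter Topology
open scoped ENNReal NNReal RealInnerProductSpace
open Literature.Analysis.FluidPDE Literature.Analysis.FunctionSpaces
open Literature.Analysis.FluidPDE.LPBounds (gradSq)
open Summit.NavierStokesRegularity.FluidComputer.BlockEnergyTransport
open Summit.NavierStokesRegularity.FluidComputer.BlockEnergyIdentity

namespace Summit.NavierStokesRegularity.FluidComputer.LevelFluxFloor

/-! ## L16 — band flux ≥ band rent − band stock -/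

/-- **L16 — BAND FLUX ≥ BAND RENT − BAND STOCK.** For every maximal smooth solution `(u, p)` of the unforced
Navier–Stokes system on `ℝ³ × [0, T)` (`ν > 0`) which is Leray–Hopf from `u 0`, all `0 < s ≤ t < T` and every FINITE
SET OF LEVELS `B`: with the band flux `Π_B(τ) = −∑_{j∈B} N_j(u(τ))`, `N_j(w) = ∫⟪Δ̇_j w, Δ̇_j((w·∇)w)⟫`,
`(ν/(3C_r²)) ∑_{j∈B} 4^j ∫_s^t ‖Δ̇_j u(τ)‖₂² dτ − ½ ∑_{j∈B} ‖Δ̇_j u(s)‖₂² ≤ ∫_s^t Π_B(u(τ)) dτ = −∑_{j∈B} ∫_s^t N_j(u(τ)) dτ`.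
The NET energy handed into a band over a window (energy exchanged between two levels of the band cancels) pays at least
the band's viscous rent minus its initial stock (`BlockEnergyIdentity.neg_integral_transfer_ge`, summed; the flux is the
time integral of `Π_B` by `intervalIntegral.integral_finsetSum`). [cite: CheskidovShvydkoy2010, Lemma 3.2 (proof, (8))] -/
theorem band_flux_ge {ν T : ℝ} (hν : 0 < ν) (hT : 0 < T)
    {u : ℝ → EuclideanSpace ℝ (Fin 3) → EuclideanSpace ℝ (Fin 3)} {p : ℝ → EuclideanSpace ℝ (Fin 3) → ℝ}
    (hmax : IsMaximalSmoothSolution ν 0 u p T) (hLH : IsLerayHopfOn T ν 0 (u 0) u)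
    {s t : ℝ} (hs : 0 < s) (hst : s ≤ t) (htT : t < T) (B : Finset ℤ) :
    ν / (3 * ((lpBounds (Fin 3)).Cr : ℝ) ^ 2) * ∑ j ∈ B, (4 : ℝ) ^ j * (∫ τ in s..t, (blockL2 (u τ) j ^ 2).toReal) -
        (∑ j ∈ B, (blockL2 (u s) j ^ 2).toReal) / 2 ≤
      -∑ j ∈ B, (∫ τ in s..t, ∫ x, ⟪blockFn j (u τ) x, blockFn j (convect (u τ) (u τ)) x⟫) ∧
    -∑ j ∈ B, (∫ τ in s..t, ∫ x, ⟪blockFn j (u τ) x, blockFn j (convect (u τ) (u τ)) x⟫) =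
      ∫ τ in s..t, -∑ j ∈ B, ∫ x, ⟪blockFn j (u τ) x, blockFn j (convect (u τ) (u τ)) x⟫ := by
  constructor
  · have hsum : ∀ j ∈ B,
        ν / (3 * ((lpBounds (Fin 3)).Cr : ℝ) ^ 2) * ((4 : ℝ) ^ j * ∫ τ in s..t, (blockL2 (u τ) j ^ 2).toReal) -
          (blockL2 (u s) j ^ 2).toReal / 2 ≤
        -(∫ τ in s..t, ∫ x, ⟪blockFn j (u τ) x, blockFn j (convect (u τ) (u τ)) x⟫) := by
      intro j _
      obtain ⟨h1, h2⟩ := neg_integral_transfer_ge hν hT hmax hLH hs hst htT j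
      have h3 : ν / (3 * ((lpBounds (Fin 3)).Cr : ℝ) ^ 2) * ((4 : ℝ) ^ j * ∫ τ in s..t, (blockL2 (u τ) j ^ 2).toReal)
          = ν * (4 : ℝ) ^ j / (3 * ((lpBounds (Fin 3)).Cr : ℝ) ^ 2) * ∫ τ in s..t, (blockL2 (u τ) j ^ 2).toReal := by
        ring
      rw [h3]
      linarith
    have h := Finset.sum_le_sum hsum
    rw [Finset.sum_neg_distrib] at h
    refine le_trans (le_of_eq ?_) h
    rw [Finset.sum_sub_distrib, Finset.mul_sum, Finset.sum_div]
  · rw [intervalIntegral.integral_neg, intervalIntegral.integral_finsetSum fun j _ =>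
      (blockL2_sq_toReal_sub_eq hν hT hmax hLH hs hst htT j).1]

/-! ## Bookkeeping for the forward-flux floor -/

/-- Real arithmetic of the half-integer power: `(2:ℝ≥0∞)^{q·3/2}` has real part `2^q √(2^q)`. [folklore] -/
theorem toReal_two_rpow_three_halves (q : ℕ) :
    ((2 : ℝ≥0∞) ^ ((q : ℝ) * (3 / 2))).toReal = (2 : ℝ) ^ q * Real.sqrt ((2 : ℝ) ^ q) := by
  rw [← ENNReal.toReal_rpow, ENNReal.toReal_ofNat,
    show (q : ℝ) * (3 / 2) = (q : ℝ) + (q : ℝ) * (1 / 2) by ring,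
    Real.rpow_add (by norm_num : (0 : ℝ) < 2), Real.rpow_natCast, Real.rpow_mul (by norm_num : (0 : ℝ) ≤ 2),
    Real.rpow_natCast, Real.sqrt_eq_rpow]

/-- Window sup-amplitude ≤ energy (Young/Bernstein `L² → L^∞` on the blocks + Leray's energy bound): for a Leray–Hopf
solution from `u 0` and every `t₀ ≥ 0`, `sup_{(t₀,T)} ‖Δ̇_q u‖_∞ ≤ C 2^{3q/2} ‖u(0)‖₂`
(cf. `LevelOccupationFloor.exists_blockSup_le_energy`, the window `(T/2, T)`). [cite: BahouriCheminDanchin2011, Lemma 2.1] -/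
theorem exists_iSup_blockSup_le_energy :
    ∃ C : ℝ≥0, ∀ (ν T : ℝ), 0 ≤ ν →
      ∀ (u : ℝ → EuclideanSpace ℝ (Fin 3) → EuclideanSpace ℝ (Fin 3)), IsLerayHopfOn T ν 0 (u 0) u →
      ∀ t₀ : ℝ, 0 ≤ t₀ → ∀ q : ℕ, (⨆ τ ∈ Ioo t₀ T, blockSup (u τ) q) ≤
        C * (2 : ℝ≥0∞) ^ ((q : ℝ) * (3 / 2)) * eLpNorm (u 0) 2 volume := by
  obtain ⟨C, hC⟩ := exists_eLpNorm_top_blockFn_le (E := EuclideanSpace ℝ (Fin 3)) (ι := Fin 3)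
  refine ⟨C, fun ν T hν u hLH t₀ ht₀ q => iSup₂_le fun τ hτ => ?_⟩
  have hτ' : τ ∈ Icc 0 T := ⟨ht₀.trans hτ.1.le, hτ.2.le⟩
  have h1 := hC (q : ℤ) (u τ) (hLH.memLp τ hτ')
  have h2 : eLpNorm (u τ) 2 volume ≤ eLpNorm (u 0) 2 volume :=
    hLH.eLpNorm_le_eLpNorm_datum hν (hLH.memLp 0 ⟨le_rfl, hτ'.1.trans hτ'.2⟩) hτ'
  have hexp : ((q : ℤ) : ℝ) * Module.finrank ℝ (EuclideanSpace ℝ (Fin 3)) * 2⁻¹ = (q : ℝ) * (3 / 2) := by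
    rw [finrank_euclideanSpace_fin]; push_cast; ring
  rw [hexp] at h1
  exact h1.trans (by gcongr)

/-- **Truncation of the tail (monotone convergence).** If `Y < ∫⁻_{(t₀,T)} G` then already `Y < ∫⁻_{(t₀,t₁)} G` for some
`t₁ ∈ (t₀, T)` (the windows `(t₀, T − (T−t₀)/(n+2))` exhaust `(t₀, T)`; `setLIntegral_iUnion_of_directed`). [folklore] -/
theorem exists_lt_setLIntegral_Ioo_of_lt {G : ℝ → ℝ≥0∞} {t₀ T : ℝ} (ht₀ : t₀ < T) {Y : ℝ≥0∞}
    (hY : Y < ∫⁻ τ in Ioo t₀ T, G τ) : ∃ t₁ ∈ Ioo t₀ T, Y < ∫⁻ τ in Ioo t₀ t₁, G τ := by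
  set w : ℕ → ℝ := fun n => T - (T - t₀) / ((n : ℝ) + 2) with hw
  have hwT : ∀ n, w n < T := fun n => by
    simp only [hw]; have : 0 < (T - t₀) / ((n : ℝ) + 2) := by positivity
    linarith
  have hwt₀ : ∀ n, t₀ < w n := fun n => by
    simp only [hw]
    have h2 : (T - t₀) / ((n : ℝ) + 2) < T - t₀ := by
      rw [div_lt_iff₀ (by positivity)]; nlinarith [sub_pos.2 ht₀]
    linarith
  have hmono : Monotone w := fun m n hmn => by
    simp only [hw]
    have : (T - t₀) / ((n : ℝ) + 2) ≤ (T - t₀) / ((m : ℝ) + 2) :=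
      div_le_div_of_nonneg_left (sub_pos.2 ht₀).le (by positivity) (by exact_mod_cast Nat.add_le_add_right hmn 2)
    linarith
  have hdir : Directed (· ⊆ ·) fun n => Ioo t₀ (w n) :=
    Monotone.directed_le fun m n hmn => Ioo_subset_Ioo_right (hmono hmn)
  have hunion : (⋃ n, Ioo t₀ (w n)) = Ioo t₀ T := by
    refine Subset.antisymm (iUnion_subset fun n => Ioo_subset_Ioo_right (hwT n).le) fun τ hτ => ?_
    obtain ⟨n, hn⟩ := exists_nat_gt ((T - t₀) / (T - τ))
    refine mem_iUnion.2 ⟨n, hτ.1, ?_⟩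
    simp only [hw]
    have hTτ : 0 < T - τ := sub_pos.2 hτ.2
    have h1 : (T - t₀) / ((n : ℝ) + 2) < T - τ := by
      rw [div_lt_iff₀ (by positivity)]
      rw [div_lt_iff₀ hTτ] at hn
      nlinarith
    linarith
  rw [← hunion, setLIntegral_iUnion_of_directed _ hdir, lt_iSup_iff] at hY
  obtain ⟨n, hn⟩ := hY
  exact ⟨w n, ⟨hwt₀ n, hwT n⟩, hn⟩

/-- Block energy-time in real form: for `[t₀, t₁] ⊂ (0, T)` along a maximal smooth solution Leray–Hopf from `u 0`,
`∫⁻_{(t₀,t₁)} ‖Δ̇_j u‖₂² = ofReal (∫_{t₀}^{t₁} ‖Δ̇_j u(τ)‖₂² dτ)` (block energies are continuous and finite on the open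
lifespan). [folklore] -/
theorem setLIntegral_blockL2_sq_eq_ofReal {ν T : ℝ} (hν : 0 < ν) (hT : 0 < T)
    {u : ℝ → EuclideanSpace ℝ (Fin 3) → EuclideanSpace ℝ (Fin 3)} {p : ℝ → EuclideanSpace ℝ (Fin 3) → ℝ}
    (hmax : IsMaximalSmoothSolution ν 0 u p T) (hLH : IsLerayHopfOn T ν 0 (u 0) u)
    {t₀ t₁ : ℝ} (ht₀ : 0 < t₀) (h01 : t₀ ≤ t₁) (ht₁ : t₁ < T) (j : ℤ) :
    ∫⁻ τ in Ioo t₀ t₁, blockL2 (u τ) j ^ 2 = ENNReal.ofReal (∫ τ in t₀..t₁, (blockL2 (u τ) j ^ 2).toReal) ∧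
      IntervalIntegrable (fun τ => (blockL2 (u τ) j ^ 2).toReal) volume t₀ t₁ := by
  have hfin : ∀ τ ∈ Icc t₀ t₁, blockL2 (u τ) j ^ 2 ≠ ∞ := fun τ hτ =>
    ENNReal.pow_ne_top ((isSmoothL2Field_slice_of_maximal hν hT hmax hLH
      ⟨ht₀.trans_le hτ.1, hτ.2.trans_lt ht₁⟩).blockFn j).memLp_two.eLpNorm_ne_top
  have hcont : ContinuousOn (fun τ => (blockL2 (u τ) j ^ 2).toReal) (Icc t₀ t₁) :=
    ENNReal.continuousOn_toReal.comp ((BlockEnergyContinuity.continuousOn_blockL2_sq hν hT hmax hLH j).mono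
      fun τ hτ => ⟨ht₀.trans_le hτ.1, hτ.2.trans_lt ht₁⟩) hfin
  have hii : IntervalIntegrable (fun τ => (blockL2 (u τ) j ^ 2).toReal) volume t₀ t₁ := by
    refine ContinuousOn.intervalIntegrable ?_
    rwa [uIcc_of_le h01]
  refine ⟨?_, hii⟩
  have hint : IntegrableOn (fun τ => (blockL2 (u τ) j ^ 2).toReal) (Ioo t₀ t₁) volume :=
    (hcont.integrableOn_compact isCompact_Icc).mono_set Ioo_subset_Icc_self
  rw [intervalIntegral.integral_of_le h01, integral_Ioc_eq_integral_Ioo,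
    ofReal_integral_eq_lintegral_ofReal hint (ae_of_all _ fun τ => ENNReal.toReal_nonneg)]
  refine setLIntegral_congr_fun measurableSet_Ioo fun τ hτ => ?_
  rw [ENNReal.ofReal_toReal (hfin τ ⟨hτ.1.le, hτ.2.le⟩)]

/-- **The stock of a high band is small at an interior time**: for every smooth `L²` field `w` and `q ≤ q + k`,
`4^q ∑_{k<N} ‖Δ̇_{q+k} w‖₂² ≤ F(w) = ∑_l 4^l ‖Δ̇_l w‖₂²` (`dyadicF`), finite for smooth `L²` fields. [folklore] -/
theorem four_pow_mul_sum_blockL2_sq_le (w : EuclideanSpace ℝ (Fin 3) → EuclideanSpace ℝ (Fin 3)) (q N : ℕ) :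
    (2 : ℝ≥0∞) ^ (2 * q) * ∑ k ∈ Finset.range N, blockL2 w ((q + k : ℕ) : ℤ) ^ 2 ≤ dyadicF w := by
  classical
  calc (2 : ℝ≥0∞) ^ (2 * q) * ∑ k ∈ Finset.range N, blockL2 w ((q + k : ℕ) : ℤ) ^ 2
      = ∑ k ∈ Finset.range N, (2 : ℝ≥0∞) ^ (2 * q) * blockL2 w ((q + k : ℕ) : ℤ) ^ 2 := Finset.mul_sum _ _ _
    _ ≤ ∑ k ∈ Finset.range N, ((2 : ℝ≥0∞) ^ (((q + k : ℕ) : ℤ)) * blockL2 w ((q + k : ℕ) : ℤ)) ^ 2 := by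
        refine Finset.sum_le_sum fun k _ => ?_
        rw [mul_pow, zpow_natCast, ← pow_mul]
        exact mul_le_mul' (pow_le_pow_right₀ one_le_two (by omega)) le_rfl
    _ = ∑ l ∈ (Finset.range N).image (fun k : ℕ => ((q + k : ℕ) : ℤ)),
          ((2 : ℝ≥0∞) ^ l * blockL2 w l) ^ 2 := by
        rw [Finset.sum_image fun a _ b _ h => by simpa using h]
    _ ≤ dyadicF w := ENNReal.sum_le_tsum _

/-- `F(w) < ∞` for a smooth `L²` field (`dyadicF_le_gradSq` and `∂_i w ∈ L²`). [folklore] -/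
theorem dyadicF_ne_top {w : EuclideanSpace ℝ (Fin 3) → EuclideanSpace ℝ (Fin 3)} (hw : IsSmoothL2Field w) :
    dyadicF w ≠ ∞ := by
  have h := (lpBounds (Fin 3)).dyadicF_le_gradSq hw
  refine ne_top_of_le_ne_top ?_ h
  refine ENNReal.mul_ne_top (by norm_num) (ENNReal.mul_ne_top (ENNReal.natCast_ne_top _)
    (ENNReal.mul_ne_top (ENNReal.pow_ne_top ENNReal.coe_ne_top) ?_))
  simp only [gradSq]
  exact ENNReal.sum_ne_top.2 fun i _ => ENNReal.pow_ne_top (hw.memLp_fderiv_apply _).eLpNorm_ne_top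

end Summit.NavierStokesRegularity.FluidComputer.LevelFluxFloor

end
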